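import Mathlib
import Summits.RiemannHypothesis.RiemannHypothesis.Theorems.WeilGroundStateGroundStateSimpleEvenArchAtoms
import Summits.RiemannHypothesis.RiemannHypothesis.Theorems.WeilGroundStateGroundStateSimpleEvenStubHyperbolicBounds
import Summits.RiemannHypothesis.RiemannHypothesis.Theorems.WeilGroundStateGroundStateSimpleEvenStubLogAtoms
import Literature.Analysis.SpecialFunctions.DigammaVerticalSeries
import HarnessLib

/-!
# Crux `GroundStateSimpleEven` (stmt-RiemannHypothesis-1526), line `parity-multiplicity-commutator` v3:
# the odd lower bound — preparatory inequalities (E-free)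

Support file (`--supports stmt-RiemannHypothesis-1526`) of the lead's stub `stub_archimedeanWindows`
(the crux on every archimedean window `0 < a ≤ (log 2)/2`, by the Fourier bathtub for the odd
sector against the parabola's Rayleigh quotient).
Monotonicity in `c` of the Lorentzians of the relaxed minorant, the algebra combining `π·X + Y ≤ I` with the factor `1/π`, the polynomial bound of `sinh c − c`, and decimal bounds of the constant `Re ψ(1/4) + 4 + 4/5 + 2/9 + log 2 − 2 log 3` and of `log π`.
Everything is GENERIC in the cap `E : ℝ → ℝ`: its values on the 27 pieces (the Taylor polynomial
`2u²/3 − 2u⁴/15 + 4u⁶/315` on `(0, 7/5]`, certified constants on 24 panels with 7-smooth rational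
ends up to `16/5`, `1` on `(16/5, 47/10]`, `2` beyond, `1` at `u ≤ 0`) and its measurability are
SECTION HYPOTHESES, included where used; the cap itself is constructed once, in
`…ArchCapExists.lean`.  Generated mechanically from the certified table of the lead's folder
(`work/numerics/final_design.py`, `gen2.py`); every constant is re-checked by the kernel.
-/

noncomputable section

open Set MeasureTheory Filter
open scoped Real Topology

namespace Summit.RiemannHypothesis.RiemannHypothesis.Theorems.GroundStateSimpleEven


set_option linter.dupNamespace false in
/-- The subtracted Lorentzians `Λ₊(u, c)` are non-decreasing in `c > 0`. [folklore] -/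
theorem arch_Lp_mono {c c₀ u : ℝ} (hc : 0 < c) (h : c ≤ c₀) :
    c ^ 2 / (c ^ 2 / 4 + u ^ 2) + 5 * c ^ 2 / (25 * c ^ 2 / 4 + u ^ 2) + 9 * c ^ 2 / 2 / (81 * c ^ 2 / 4 + u ^ 2) ≤
      c₀ ^ 2 / (c₀ ^ 2 / 4 + u ^ 2) + 5 * c₀ ^ 2 / (25 * c₀ ^ 2 / 4 + u ^ 2) + 9 * c₀ ^ 2 / 2 / (81 * c₀ ^ 2 / 4 + u ^ 2) := by
  have hc0 : 0 < c₀ := hc.trans_le h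
  have hcc : c ^ 2 ≤ c₀ ^ 2 := pow_le_pow_left₀ hc.le h 2
  have key : ∀ {p q : ℝ}, 0 < p → 0 < q →
      p * c ^ 2 / (q * c ^ 2 + u ^ 2) ≤ p * c₀ ^ 2 / (q * c₀ ^ 2 + u ^ 2) := by
    intro p q hp hq
    rw [div_le_div_iff₀ (by positivity) (by positivity)]
    nlinarith [sq_nonneg u, mul_nonneg (mul_nonneg hp.le hq.le) (sq_nonneg u)]
  have k1 := key (p := 1) (q := 1 / 4) one_pos (by norm_num)
  have k2 := key (p := 5) (q := 25 / 4) (by norm_num) (by norm_num)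
  have k3 := key (p := 9 / 2) (q := 81 / 4) (by norm_num) (by norm_num)
  have e1 : ∀ x : ℝ, x ^ 2 / (x ^ 2 / 4 + u ^ 2) = 1 * x ^ 2 / (1 / 4 * x ^ 2 + u ^ 2) := fun x ↦ by ring_nf
  have e2 : ∀ x : ℝ, 5 * x ^ 2 / (25 * x ^ 2 / 4 + u ^ 2) = 5 * x ^ 2 / (25 / 4 * x ^ 2 + u ^ 2) :=
    fun x ↦ by ring_nf
  have e3 : ∀ x : ℝ, 9 * x ^ 2 / 2 / (81 * x ^ 2 / 4 + u ^ 2) = 9 / 2 * x ^ 2 / (81 / 4 * x ^ 2 + u ^ 2) :=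
    fun x ↦ by ring_nf
  rw [e1, e2, e3, e1, e2, e3]
  linarith

set_option linter.dupNamespace false in
/-- The Padé gain `Λ₋(u, c) = 9c²/(9c² + u²)` is non-decreasing in `c > 0`. [folklore] -/
theorem arch_Lm_mono {c₁ c u : ℝ} (hc₁ : 0 < c₁) (h : c₁ ≤ c) :
    9 * c₁ ^ 2 / (9 * c₁ ^ 2 + u ^ 2) ≤ 9 * c ^ 2 / (9 * c ^ 2 + u ^ 2) := by
  have hc : 0 < c := hc₁.trans_le h
  have hcc : c₁ ^ 2 ≤ c ^ 2 := pow_le_pow_left₀ hc₁.le h 2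
  rw [div_le_div_iff₀ (by positivity) (by positivity)]
  nlinarith [sq_nonneg u, mul_nonneg (by norm_num : (0:ℝ) ≤ 9) (sq_nonneg u)]

set_option linter.dupNamespace false in
/-- Combining `π·X + Y ≤ I` (`Y ≥ 0`) with the factor `1/π`: `X + Y/3.141592654 ≤ (1/π)·I`. [folklore] -/
theorem arch_combine {I X Y : ℝ} (h : Real.pi * X + Y ≤ I) (hY : 0 ≤ Y) :
    X + Y / 3.141592654 ≤ 1 / Real.pi * I := by
  have hπ := Real.pi_pos
  have hπ2 := arch_pi_lt
  have h1 : Y / 3.141592654 ≤ Y / Real.pi := div_le_div_of_nonneg_left hY hπ hπ2.le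
  have h2 : X + Y / Real.pi ≤ 1 / Real.pi * I := by
    rw [← sub_nonneg]
    have e : 1 / Real.pi * I - (X + Y / Real.pi) = (I - (Real.pi * X + Y)) / Real.pi := by
      field_simp
    rw [e]
    exact div_nonneg (by linarith) hπ.le
  linarith

set_option linter.dupNamespace false in
/-- `sinh c − c ≤ c₀³/6 + c₀⁵/100` for `0 ≤ c ≤ c₀ ≤ 1` (`stub_hyperbolicBounds`). [folklore] -/
theorem arch_sinh_poly {c c₀ : ℝ} (hc : 0 ≤ c) (h : c ≤ c₀) (h1 : c₀ ≤ 1) :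
    Real.sinh c - c ≤ c₀ ^ 3 / 6 + c₀ ^ 5 / 100 := by
  obtain ⟨-, -, h3⟩ := Summit.RiemannHypothesis.RiemannHypothesis.Theorems.stub_hyperbolicBounds c hc (h.trans h1)
  have p3 : c ^ 3 ≤ c₀ ^ 3 := pow_le_pow_left₀ hc h 3
  have p5 : c ^ 5 ≤ c₀ ^ 5 := pow_le_pow_left₀ hc h 5
  linarith

set_option linter.dupNamespace false in
/-- Decimal lower bound of the constant of the relaxed minorant:
`-0.7093088 ≤ Re ψ(1/4) + 4 + 4/5 + 2/9 + log 2 − 2 log 3`. [folklore] -/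
theorem arch_Dconst_ge :
    (-(221659 / 312500 : ℝ)) ≤ Literature.Analysis.SpecialFunctions.reDigammaQuarter 0 + 4 + 4 / 5 + 2 / 9
      + Real.log 2 - 2 * Real.log 3 := by
  have h1 := Literature.Analysis.SpecialFunctions.re_digamma_one_quarter_ge
  rw [← Literature.Analysis.SpecialFunctions.reDigammaQuarter_zero] at h1
  have h2 := Real.log_two_gt_d9
  obtain ⟨-, hl3b, -⟩ := Summit.RiemannHypothesis.RiemannHypothesis.Theorems.stub_logAtoms
  linarith

set_option linter.dupNamespace false in
/-- `log π ≤ 1.1447299` (tree). [folklore] -/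
theorem arch_logpi_le : Real.log Real.pi ≤ 1.1447299 :=
  Literature.Analysis.SpecialFunctions.Real.log_pi_le


end Summit.RiemannHypothesis.RiemannHypothesis.Theorems.GroundStateSimpleEven

namespace Summit.RiemannHypothesis.RiemannHypothesis.Theorems

set_option linter.dupNamespace false in
/-- **Registered sub-goal**: monotonicity in the window of the Lorentzians of the relaxed minorant. [folklore] -/
theorem stub_archOddLowerPrep :
    (∀ c c₀ u : ℝ, 0 < c → c ≤ c₀ →
        c ^ 2 / (c ^ 2 / 4 + u ^ 2) + 5 * c ^ 2 / (25 * c ^ 2 / 4 + u ^ 2) + 9 * c ^ 2 / 2 / (81 * c ^ 2 / 4 + u ^ 2) ≤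
          c₀ ^ 2 / (c₀ ^ 2 / 4 + u ^ 2) + 5 * c₀ ^ 2 / (25 * c₀ ^ 2 / 4 + u ^ 2) + 9 * c₀ ^ 2 / 2 / (81 * c₀ ^ 2 / 4 + u ^ 2)) ∧
      (∀ c₁ c u : ℝ, 0 < c₁ → c₁ ≤ c → 9 * c₁ ^ 2 / (9 * c₁ ^ 2 + u ^ 2) ≤ 9 * c ^ 2 / (9 * c ^ 2 + u ^ 2)) := by
  exact ⟨fun _ _ _ hc h ↦ GroundStateSimpleEven.arch_Lp_mono hc h,
    fun _ _ _ hc h ↦ GroundStateSimpleEven.arch_Lm_mono hc h⟩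

end Summit.RiemannHypothesis.RiemannHypothesis.Theorems
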